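import Summits.NavierStokesRegularity.NavierStokesRegularity.Theses.PerpetualPump

/-!
# `CircuitPump` (stmt-NavierStokesRegularity-1834): load-bearing clauses and the structure of any witness

Negative-side support lemmas for the crux `PerpetualPump.CircuitPump` (the dyadic perpetual pump: an ancient,
exactly discretely self-similar, Type-I solution of an autonomous Tao circuit at α = 2/5), extracted from the
cdisprove work file `Cruxes/CircuitPump/Disproof.lean` §(0), (a), (b) (seat
refuter-cdisprove-stmt-NavierStokesRegularity-1834-0, 2026-08-16). Sorry-free.

* `circuitPump_iff`: the crux is `Wrap IsPump` definitionally (named clauses `IsSym`, `IsCyc`, `SolvesODE`,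
  `IsDSS`, `IsTypeI`, `IsNontrivial`).
* LOAD-BEARING (the crux is existential, so a clause is load-bearing iff deleting it makes the statement
  trivially true): `withoutTypeI_holds` (free viscous decay `X_n(t) = lam^{-n/5}e^{-lam^{4n/5}t}`, `coeff = 0`,
  is an exactly 1-DSS nontrivial ancient solution), `withoutODE_holds` (the saturated Type-I power
  `lam^{-3n/5}/√(-t)` is 1-DSS, Type I, nontrivial), `withoutNontrivial_holds` (`X = 0`). So every disproof
  must be an ODE Liouville theorem that uses the Type-I decay as `t → -∞`, and every proof must defeat it.
* Companion file `Negative/WitnessStructure.lean`: structure every witness must have (`no_free_mode`,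
  `steady_mode_trivial`, DSS propagation, the `m = 1` classification as the signed Katz–Pavlović chain).
-/

set_option linter.dupNamespace false

noncomputable section

open scoped BigOperators
open Real Set

namespace Summit.NavierStokesRegularity.NavierStokesRegularity.Theorems.CircuitPumpNegative

/-! ## (0) The crux through named clauses -/

variable {m : ℕ}

/-- Tao's symmetry (4.2) in the crux encoding. -/
def IsSym (coeff : Fin m → Fin m → Fin m → Option (Fin 3) → ℝ) : Prop :=
  ∀ (i₁ i₂ i₃ : Fin m) (μ : Option (Fin 3)),
    coeff i₁ i₂ i₃ μ = coeff i₂ i₁ i₃ (Option.map (Equiv.swap (0 : Fin 3) 1) μ)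

/-- Cyclic cancellation (energy conservation of the nonlinearity) in the crux encoding. -/
def IsCyc (coeff : Fin m → Fin m → Fin m → Option (Fin 3) → ℝ) : Prop :=
  ∀ (v : Fin 3 → Fin m) (μ : Option (Fin 3)),
    ∑ σ : Equiv.Perm (Fin 3), coeff (v (σ 0)) (v (σ 1)) (v (σ 2)) (Option.map σ.symm μ) = 0

/-- The crux's right-hand side `F i n t` (viscous Tao circuit, class (4.3), α = 2/5). -/
def rhsF (lam : ℝ) (coeff : Fin m → Fin m → Fin m → Option (Fin 3) → ℝ) (X : Fin m → ℤ → ℝ → ℝ)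
    (i : Fin m) (n : ℤ) (t : ℝ) : ℝ :=
  -(lam ^ ((4 / 5 : ℝ) * n)) * X i n t +
    ∑ i₁ : Fin m, ∑ i₂ : Fin m, ∑ μ : Option (Fin 3),
      coeff i₁ i₂ i μ * lam ^ ((n : ℝ) - (if μ = some 2 then 1 else 0)) *
        X i₁ (n + ((if μ = some 0 then 1 else 0) - (if μ = some 2 then 1 else 0))) t *
        X i₂ (n + ((if μ = some 1 then 1 else 0) - (if μ = some 2 then 1 else 0))) t

/-- The ODE clause: the circuit equations hold for all `t < 0`. -/
def SolvesODE (lam : ℝ) (coeff : Fin m → Fin m → Fin m → Option (Fin 3) → ℝ)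
    (X : Fin m → ℤ → ℝ → ℝ) : Prop :=
  ∀ (i : Fin m) (n : ℤ) (t : ℝ), t < 0 → HasDerivAt (X i n) (rhsF lam coeff X i n t) t

/-- Exact discrete self-similarity with period `k`. -/
def IsDSS (lam : ℝ) (k : ℕ) (X : Fin m → ℤ → ℝ → ℝ) : Prop :=
  ∀ (i : Fin m) (n : ℤ) (t : ℝ), t < 0 →
    X i (n + k) (lam ^ (-((4 / 5 : ℝ) * k)) * t) = lam ^ (-((1 / 5 : ℝ) * k)) * X i n t

/-- Type I in time: `lam^{3n/5}|X_{i,n}(t)| ≤ C/√(-t)`. -/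
def IsTypeI (lam : ℝ) (X : Fin m → ℤ → ℝ → ℝ) : Prop :=
  ∃ C : ℝ, ∀ (i : Fin m) (n : ℤ) (t : ℝ), t < 0 → lam ^ ((3 / 5 : ℝ) * n) * |X i n t| ≤ C / Real.sqrt (-t)

/-- Nontriviality. -/
def IsNontrivial (X : Fin m → ℤ → ℝ → ℝ) : Prop :=
  ∃ (i : Fin m) (n : ℤ) (t : ℝ), t < 0 ∧ X i n t ≠ 0

/-- The `∀ lam₀ ∃ lam ∈ (1, lam₀) ∃ m coeff k X, P` wrapper of the crux. -/
def Wrap (P : ∀ (lam : ℝ) (m : ℕ), (Fin m → Fin m → Fin m → Option (Fin 3) → ℝ) → ℕ →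
    (Fin m → ℤ → ℝ → ℝ) → Prop) : Prop :=
  ∀ lam₀ : ℝ, 1 < lam₀ → ∃ lam : ℝ, 1 < lam ∧ lam < lam₀ ∧
    ∃ (m : ℕ) (coeff : Fin m → Fin m → Fin m → Option (Fin 3) → ℝ) (k : ℕ) (X : Fin m → ℤ → ℝ → ℝ),
      P lam m coeff k X

/-- All seven clauses of the crux. -/
def IsPump (lam : ℝ) (m : ℕ) (coeff : Fin m → Fin m → Fin m → Option (Fin 3) → ℝ) (k : ℕ)
    (X : Fin m → ℤ → ℝ → ℝ) : Prop :=
  IsSym coeff ∧ IsCyc coeff ∧ 1 ≤ k ∧ SolvesODE lam coeff X ∧ IsDSS lam k X ∧ IsTypeI lam X ∧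
    IsNontrivial X

/-- The crux IS `Wrap IsPump`, definitionally. -/
theorem circuitPump_iff : Theses.PerpetualPump.CircuitPump ↔ Wrap IsPump := Iff.rfl

/-! ## (a) Load-bearing analysis: delete one clause, exhibit a cheap witness -/

/-- The crux with the Type-I clause deleted. -/
def WithoutTypeI : Prop :=
  Wrap fun lam _ coeff k X => IsSym coeff ∧ IsCyc coeff ∧ 1 ≤ k ∧ SolvesODE lam coeff X ∧
    IsDSS lam k X ∧ IsNontrivial X

/-- The crux with the ODE clause deleted. -/
def WithoutODE : Prop :=
  Wrap fun lam _ coeff k X => IsSym coeff ∧ IsCyc coeff ∧ 1 ≤ k ∧ IsDSS lam k X ∧ IsTypeI lam X ∧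
    IsNontrivial X

/-- The crux with the nontriviality clause deleted. -/
def WithoutNontrivial : Prop :=
  Wrap fun lam _ coeff k X => IsSym coeff ∧ IsCyc coeff ∧ 1 ≤ k ∧ SolvesODE lam coeff X ∧
    IsDSS lam k X ∧ IsTypeI lam X

/-- `lam ∈ (1, lam₀)` exists. -/
theorem exists_fine_lam {lam₀ : ℝ} (h : 1 < lam₀) : ∃ lam : ℝ, 1 < lam ∧ lam < lam₀ :=
  ⟨(1 + lam₀) / 2, by linarith, by linarith⟩

/-- Zero structure constants are symmetric. -/
theorem isSym_zero : IsSym (fun (_ _ _ : Fin m) (_ : Option (Fin 3)) => (0 : ℝ)) := by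
  intro _ _ _ _; rfl

/-- Zero structure constants are cyclically cancelling. -/
theorem isCyc_zero : IsCyc (fun (_ _ _ : Fin m) (_ : Option (Fin 3)) => (0 : ℝ)) := by
  intro v μ
  exact Finset.sum_eq_zero fun _ _ => rfl

/-- With zero structure constants the right-hand side is the free viscous decay. -/
theorem rhsF_zero_coeff (lam : ℝ) (X : Fin m → ℤ → ℝ → ℝ) (i : Fin m) (n : ℤ) (t : ℝ) :
    rhsF lam (fun _ _ _ _ => 0) X i n t = -(lam ^ ((4 / 5 : ℝ) * n)) * X i n t := by
  simp [rhsF]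

/-- FREE VISCOUS DECAY `X_n(t) = lam^{-n/5} exp(-lam^{4n/5} t)`: the witness for `WithoutTypeI`. -/
def freeX (lam : ℝ) : Fin 1 → ℤ → ℝ → ℝ :=
  fun _ n t => lam ^ (-((1 / 5 : ℝ) * n)) * Real.exp (-(lam ^ ((4 / 5 : ℝ) * n)) * t)

/-- The free decay solves `ẋ = -lam^{4n/5} x`. -/
theorem freeX_hasDerivAt {lam : ℝ} (i : Fin 1) (n : ℤ) (t : ℝ) :
    HasDerivAt (freeX lam i n) (-(lam ^ ((4 / 5 : ℝ) * n)) * freeX lam i n t) t := by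
  have h1 : HasDerivAt (fun s : ℝ => -(lam ^ ((4 / 5 : ℝ) * n)) * s) (-(lam ^ ((4 / 5 : ℝ) * n)) * 1) t :=
    (hasDerivAt_id t).const_mul _
  have h2 := (h1.exp).const_mul (lam ^ (-((1 / 5 : ℝ) * n)))
  refine h2.congr_deriv ?_
  simp only [freeX]
  ring

/-- The free decay is exactly 1-DSS. -/
theorem freeX_dss {lam : ℝ} (hlam : 1 < lam) (i : Fin 1) (n : ℤ) (t : ℝ) :
    freeX lam i (n + (1 : ℕ)) (lam ^ (-((4 / 5 : ℝ) * (1 : ℕ))) * t) =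
      lam ^ (-((1 / 5 : ℝ) * (1 : ℕ))) * freeX lam i n t := by
  have hpos : 0 < lam := by linarith
  simp only [freeX, Nat.cast_one, mul_one]
  have h1 : lam ^ ((4 / 5 : ℝ) * ((n + 1 : ℤ) : ℝ)) * (lam ^ (-(4 / 5 : ℝ)) * t) =
      lam ^ ((4 / 5 : ℝ) * (n : ℝ)) * t := by
    push_cast
    have : lam ^ ((4 / 5 : ℝ) * ((n : ℝ) + 1)) * lam ^ (-(4 / 5 : ℝ)) = lam ^ ((4 / 5 : ℝ) * (n : ℝ)) := by
      rw [← Real.rpow_add hpos]; congr 1; ring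
    calc lam ^ ((4 / 5 : ℝ) * ((n : ℝ) + 1)) * (lam ^ (-(4 / 5 : ℝ)) * t)
        = (lam ^ ((4 / 5 : ℝ) * ((n : ℝ) + 1)) * lam ^ (-(4 / 5 : ℝ))) * t := by ring
      _ = lam ^ ((4 / 5 : ℝ) * (n : ℝ)) * t := by rw [this]
  have h2 : lam ^ (-((1 / 5 : ℝ) * ((n + 1 : ℤ) : ℝ))) =
      lam ^ (-(1 / 5 : ℝ)) * lam ^ (-((1 / 5 : ℝ) * (n : ℝ))) := by
    push_cast
    rw [← Real.rpow_add hpos]; congr 1; ring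
  have h1' : -lam ^ ((4 / 5 : ℝ) * ((n + 1 : ℤ) : ℝ)) * (lam ^ (-(4 / 5 : ℝ)) * t) =
      -lam ^ ((4 / 5 : ℝ) * (n : ℝ)) * t := by
    rw [neg_mul, neg_mul, h1]
  rw [h1', h2]
  ring

/-- **(a1) Type I is load-bearing**: without it the crux is trivially true (free decay, `coeff = 0`,
`m = k = 1`). Any disproof must use the decay `|X_{i,n}(t)| ≤ C lam^{-3n/5}/√(-t)` as `t → -∞`. -/
theorem withoutTypeI_holds : WithoutTypeI := by
  intro lam₀ hlam₀
  obtain ⟨lam, hlam, hlt⟩ := exists_fine_lam hlam₀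
  refine ⟨lam, hlam, hlt, 1, fun _ _ _ _ => 0, 1, freeX lam, isSym_zero, isCyc_zero, le_rfl, ?_, ?_, ?_⟩
  · intro i n t _
    rw [rhsF_zero_coeff]
    exact freeX_hasDerivAt i n t
  · intro i n t _
    exact freeX_dss hlam i n t
  · refine ⟨0, 0, -1, by norm_num, ?_⟩
    have hpos : 0 < lam := by linarith
    simp only [freeX]
    exact mul_ne_zero (Real.rpow_pos_of_pos hpos _).ne' (Real.exp_pos _).ne'

/-- SATURATED TYPE-I POWER `X_n(t) = lam^{-3n/5}/√(-t)`: the witness for `WithoutODE`. -/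
def powX (lam : ℝ) : Fin 1 → ℤ → ℝ → ℝ :=
  fun _ n t => lam ^ (-((3 / 5 : ℝ) * n)) / Real.sqrt (-t)

/-- The saturated Type-I power is exactly 1-DSS. -/
theorem powX_dss {lam : ℝ} (hlam : 1 < lam) (i : Fin 1) (n : ℤ) (t : ℝ) (ht : t < 0) :
    powX lam i (n + (1 : ℕ)) (lam ^ (-((4 / 5 : ℝ) * (1 : ℕ))) * t) =
      lam ^ (-((1 / 5 : ℝ) * (1 : ℕ))) * powX lam i n t := by
  have hpos : 0 < lam := by linarith
  have hnt : 0 < -t := by linarith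
  simp only [powX, Nat.cast_one, mul_one]
  have hs : Real.sqrt (-(lam ^ (-(4 / 5 : ℝ)) * t)) = lam ^ (-(2 / 5 : ℝ)) * Real.sqrt (-t) := by
    rw [show -(lam ^ (-(4 / 5 : ℝ)) * t) = lam ^ (-(4 / 5 : ℝ)) * (-t) by ring,
      Real.sqrt_mul (Real.rpow_nonneg hpos.le _), Real.sqrt_eq_rpow, ← Real.rpow_mul hpos.le]
    norm_num
  rw [hs]
  have h3 : lam ^ (-((3 / 5 : ℝ) * ((n + 1 : ℤ) : ℝ))) =
      lam ^ (-((3 / 5 : ℝ) * (n : ℝ))) * lam ^ (-(3 / 5 : ℝ)) := by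
    push_cast
    rw [← Real.rpow_add hpos]; congr 1; ring
  have h4 : lam ^ (-(3 / 5 : ℝ)) = lam ^ (-(1 / 5 : ℝ)) * lam ^ (-(2 / 5 : ℝ)) := by
    rw [← Real.rpow_add hpos]; norm_num
  have hsq : Real.sqrt (-t) ≠ 0 := (Real.sqrt_pos.2 hnt).ne'
  have h25 : lam ^ (-(2 / 5 : ℝ)) ≠ 0 := (Real.rpow_pos_of_pos hpos _).ne'
  rw [h3, h4]
  field_simp

/-- **(a2) The ODE is load-bearing**: without it the crux is trivially true (the saturated Type-I
power is exactly 1-DSS, Type I with `C = 1`, nontrivial; `coeff = 0`). -/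
theorem withoutODE_holds : WithoutODE := by
  intro lam₀ hlam₀
  obtain ⟨lam, hlam, hlt⟩ := exists_fine_lam hlam₀
  have hpos : 0 < lam := by linarith
  refine ⟨lam, hlam, hlt, 1, fun _ _ _ _ => 0, 1, powX lam, isSym_zero, isCyc_zero, le_rfl, ?_, ?_, ?_⟩
  · intro i n t ht
    exact powX_dss hlam i n t ht
  · refine ⟨1, fun i n t ht => ?_⟩
    have hnt : 0 < -t := by linarith
    simp only [powX]
    rw [abs_div, abs_of_pos (Real.rpow_pos_of_pos hpos _), abs_of_pos (Real.sqrt_pos.2 hnt),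
      ← mul_div_assoc, ← Real.rpow_add hpos]
    have : (3 / 5 : ℝ) * n + -((3 / 5 : ℝ) * n) = 0 := by ring
    rw [this, Real.rpow_zero]
  · refine ⟨0, 0, -1, by norm_num, ?_⟩
    simp [powX]

/-- **(a3) Nontriviality is load-bearing** (of course): `X = 0` satisfies everything else. -/
theorem withoutNontrivial_holds : WithoutNontrivial := by
  intro lam₀ hlam₀
  obtain ⟨lam, hlam, hlt⟩ := exists_fine_lam hlam₀
  refine ⟨lam, hlam, hlt, 1, fun _ _ _ _ => 0, 1, fun _ _ _ => 0, isSym_zero, isCyc_zero, le_rfl,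
    ?_, ?_, ?_⟩
  · intro i n t _
    rw [rhsF_zero_coeff]
    simpa using hasDerivAt_const t (0 : ℝ)
  · intro i n t _; simp
  · exact ⟨0, fun i n t _ => by simp⟩

end Summit.NavierStokesRegularity.NavierStokesRegularity.Theorems.CircuitPumpNegative
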